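import Mathlib
import Summits.Ventures.PercRepro2.Tail2DBlockCalc
import Summits.Ventures.PercRepro2.Tail2DHarrisSP
import Summits.Ventures.PercRepro2.Tail2DFlowOneBlocks
import Summits.Ventures.PercRepro2.Tail2DFlowOneStep01
import Summits.Ventures.PercRepro2.Tail2DParFin
import Summits.Ventures.PercRepro2.Tail2DParFinFlip
import Summits.Ventures.PercRepro2.Tail2DParFinTop
import Summits.Ventures.PercRepro2.Tail2DParFinDiag
import Summits.Ventures.PercRepro2.Tail2DParFinCount
import Summits.Ventures.PercRepro2.Tail2DParFinRelax
import Summits.Ventures.PercRepro2.Tail2DParFinSubTop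
import Summits.Ventures.PercRepro2.Tail2DParFinSubTopB
import Summits.Ventures.PercRepro2.Tail2DParFinSubTopC
import Summits.Ventures.PercRepro2.Tail2DParFinSubTopD
import Summits.Ventures.PercRepro2.Tail2DParFinFibres
import Summits.Ventures.PercRepro2.Tail2DOneChange
import Summits.Ventures.PercRepro2.Tail2DOneChangeB
import Summits.Ventures.PercRepro2.Tail2DOneChangeC
import Summits.Ventures.PercRepro2.Tail2DSDomSwap
import Summits.Ventures.PercRepro2.Tail2DBlockCertP2P2
import Summits.Ventures.PercRepro2.Tail2DFlowOneAxis
import Summits.Ventures.PercRepro2.Tail2DAxisClass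
import Summits.Ventures.PercRepro2.Tail2DFourIdent

/-!
# (SD) at every position on `Y ∥ Y ∥ Y ∥ Y ∥ Y` for any flow-one `Y` — five identical factors, part I: the tables, the counts, the `(2,0)` identities
(seat mine-b, cell pub-perc-repro2; conjectures/MINE-B.md §44)

The two positions below the sub-top level, `(2,0)` and `(3,0)` (and their duals `(1,1)`, `(1,2)`), by explicit
one-change tables (the column rule of the one-change family: the relax rate per red depends only on the number of
reds), every rate a ratio of polynomials in `a = #R_Y`, `c = #C_Y` with positive coefficients; the identities by
`sdomZ_of_oneChange`, the other positions by the top / sub-top / diagonal / axis theorems (`sdomZ_five_all`).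
-/

namespace Summit.Ventures.PercRepro2.Tail2D

open V2Closure Finset

section Five

variable (Y : V2Closure.SP)

/-- `D₂ = 30a³ + 70a²c + 60ac² + 20c³`, the denominator at `(2,0)` -/
noncomputable def d5a : ℚ := 30 * aY Y ^ 3 + 70 * aY Y ^ 2 * cY Y + 60 * aY Y * cY Y ^ 2 + 20 * cY Y ^ 3
/-- `D₃ = 25a² + 50ac + 30c²`, the denominator at `(3,0)` -/
noncomputable def d5b : ℚ := 25 * aY Y ^ 2 + 50 * aY Y * cY Y + 30 * cY Y ^ 2

/-- the identity rate at `A` by the type `(#R, #B)` -/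
noncomputable def ιA (r b : ℕ) : ℚ :=
  if r = 2 ∧ b = 1 then (34 * aY Y ^ 3 + 63 * aY Y ^ 2 * cY Y + 40 * aY Y * cY Y ^ 2 + 10 * cY Y ^ 3) / (3 * d5a Y) else
  if r = 3 ∧ b = 1 then (103 * aY Y ^ 3 + 205 * aY Y ^ 2 * cY Y + 134 * aY Y * cY Y ^ 2 + 30 * cY Y ^ 3) / (6 * d5a Y) else
  if r = 4 ∧ b = 1 then (20 * aY Y ^ 3 + 41 * aY Y ^ 2 * cY Y + 28 * aY Y * cY Y ^ 2 + 6 * cY Y ^ 3) / d5a Y else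
  if r = 2 ∧ b = 2 then (136 * aY Y ^ 3 + 274 * aY Y ^ 2 * cY Y + 200 * aY Y * cY Y ^ 2 + 60 * cY Y ^ 3) / (9 * d5a Y) else
  if r = 3 ∧ b = 2 then (126 * aY Y ^ 3 + 259 * aY Y ^ 2 * cY Y + 184 * aY Y * cY Y ^ 2 + 50 * cY Y ^ 3) / (6 * d5a Y) else
  if r = 2 ∧ b = 3 then (102 * aY Y ^ 3 + 211 * aY Y ^ 2 * cY Y + 160 * aY Y * cY Y ^ 2 + 50 * cY Y ^ 3) / (6 * d5a Y) else
  0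

/-- the flip rate per red at `A` by the type -/
noncomputable def fA (r b : ℕ) : ℚ :=
  if b = 0 then ((r : ℚ))⁻¹ else
  if r = 2 ∧ b = 1 then (34 * aY Y ^ 3 + 85 * aY Y ^ 2 * cY Y + 80 * aY Y * cY Y ^ 2 + 30 * cY Y ^ 3) / (6 * d5a Y) else
  if r = 3 ∧ b = 1 then (35 * aY Y ^ 3 + 77 * aY Y ^ 2 * cY Y + 70 * aY Y * cY Y ^ 2 + 30 * cY Y ^ 3) / (18 * d5a Y) else
  if r = 4 ∧ b = 1 then (14 * aY Y ^ 3 + 31 * aY Y ^ 2 * cY Y + 24 * aY Y * cY Y ^ 2 + 10 * cY Y ^ 3) / (12 * d5a Y) else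
  if r = 2 ∧ b = 2 then (34 * aY Y ^ 3 + 85 * aY Y ^ 2 * cY Y + 80 * aY Y * cY Y ^ 2 + 30 * cY Y ^ 3) / (9 * d5a Y) else
  if r = 3 ∧ b = 2 then (12 * aY Y ^ 3 + 23 * aY Y ^ 2 * cY Y + 20 * aY Y * cY Y ^ 2 + 10 * cY Y ^ 3) / (18 * d5a Y) else
  if r = 2 ∧ b = 3 then (34 * aY Y ^ 3 + 85 * aY Y ^ 2 * cY Y + 80 * aY Y * cY Y ^ 2 + 30 * cY Y ^ 3) / (12 * d5a Y) else
  0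

/-- the relax rate per red at `A` by the type -/
noncomputable def xA (r b : ℕ) : ℚ :=
  if r = 2 ∧ b = 1 then (11 * aY Y ^ 3 + 20 * aY Y ^ 2 * cY Y + 10 * aY Y * cY Y ^ 2) / (3 * d5a Y) else
  if r = 3 ∧ b = 1 then (7 * aY Y ^ 3 + 16 * aY Y ^ 2 * cY Y + 10 * aY Y * cY Y ^ 2) / (3 * d5a Y) else
  if r = 4 ∧ b = 1 then (4 * aY Y ^ 3 + 10 * aY Y ^ 2 * cY Y + 8 * aY Y * cY Y ^ 2) / (3 * d5a Y) else
  if r = 2 ∧ b = 2 then (11 * aY Y ^ 3 + 20 * aY Y ^ 2 * cY Y + 10 * aY Y * cY Y ^ 2) / (3 * d5a Y) else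
  if r = 3 ∧ b = 2 then (7 * aY Y ^ 3 + 16 * aY Y ^ 2 * cY Y + 10 * aY Y * cY Y ^ 2) / (3 * d5a Y) else
  if r = 2 ∧ b = 3 then (11 * aY Y ^ 3 + 20 * aY Y ^ 2 * cY Y + 10 * aY Y * cY Y ^ 2) / (3 * d5a Y) else
  0

/-- the rate table at `A` -/
noncomputable def ratesA : OCRates 5 where
  ι := fun w => ιA Y (nR 5 w) (nB 5 w)
  f := fun w _ => fA Y (nR 5 w) (nB 5 w)
  x := fun w _ => xA Y (nR 5 w) (nB 5 w)

/-- the identity rate at `B` by the type `(#R, #B)` -/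
noncomputable def ιB (r b : ℕ) : ℚ :=
  if r = 3 ∧ b = 1 then (27 * aY Y ^ 2 + 29 * aY Y * cY Y + 10 * cY Y ^ 2) / (4 * d5b Y) else
  if r = 4 ∧ b = 1 then (11 * aY Y ^ 2 + 15 * aY Y * cY Y + 4 * cY Y ^ 2) / d5b Y else
  if r = 3 ∧ b = 2 then (18 * aY Y ^ 2 + 27 * aY Y * cY Y + 15 * cY Y ^ 2) / (2 * d5b Y) else
  0

/-- the flip rate per red at `B` by the type -/
noncomputable def fB (r b : ℕ) : ℚ :=
  if b = 0 then ((r : ℚ))⁻¹ else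
  if r = 3 ∧ b = 1 then (9 * aY Y ^ 2 + 25 * aY Y * cY Y + 20 * cY Y ^ 2) / (4 * d5b Y) else
  if r = 4 ∧ b = 1 then (2 * aY Y ^ 2 + 2 * aY Y * cY Y + 5 * cY Y ^ 2) / (4 * d5b Y) else
  if r = 3 ∧ b = 2 then (9 * aY Y ^ 2 + 25 * aY Y * cY Y + 20 * cY Y ^ 2) / (6 * d5b Y) else
  0

/-- the relax rate per red at `B` by the type -/
noncomputable def xB (r b : ℕ) : ℚ :=
  if r = 3 ∧ b = 1 then (23 * aY Y ^ 2 + 25 * aY Y * cY Y) / (6 * d5b Y) else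
  if r = 4 ∧ b = 1 then (12 * aY Y ^ 2 + 21 * aY Y * cY Y) / (4 * d5b Y) else
  if r = 3 ∧ b = 2 then (23 * aY Y ^ 2 + 25 * aY Y * cY Y) / (6 * d5b Y) else
  0

/-- the rate table at `B` -/
noncomputable def ratesB : OCRates 5 where
  ι := fun w => ιB Y (nR 5 w) (nB 5 w)
  f := fun w _ => fB Y (nR 5 w) (nB 5 w)
  x := fun w _ => xB Y (nR 5 w) (nB 5 w)

variable {Y}

/-- the denominators are positive when `Y` has a red crossing -/
theorem d5a_pos (hR : 0 < (rSet Y).card) : 0 < d5a Y := by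
  unfold d5a aY cY
  have : (0 : ℚ) < (rSet Y).card := by exact_mod_cast hR
  positivity

/-- `D₃ > 0` -/
theorem d5b_pos (hR : 0 < (rSet Y).card) : 0 < d5b Y := by
  unfold d5b aY cY
  have : (0 : ℚ) < (rSet Y).card := by exact_mod_cast hR
  positivity

/-- non-negativity of the rates -/
theorem ratesA_iota_nonneg (hR : 0 < (rSet Y).card) (w : Fin 5 → Ltr) : 0 ≤ (ratesA Y).ι w := by
  have := d5a_pos hR
  show 0 ≤ ιA Y (nR 5 w) (nB 5 w)
  unfold ιA aY cY
  split_ifs <;> positivity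

/-- non-negativity of the rates -/
theorem ratesA_f_nonneg (hR : 0 < (rSet Y).card) (w : Fin 5 → Ltr) (i : Fin 5) : 0 ≤ (ratesA Y).f w i := by
  have := d5a_pos hR
  show 0 ≤ fA Y (nR 5 w) (nB 5 w)
  unfold fA aY cY
  split_ifs <;> positivity

/-- non-negativity of the rates -/
theorem ratesA_x_nonneg (hR : 0 < (rSet Y).card) (w : Fin 5 → Ltr) (i : Fin 5) : 0 ≤ (ratesA Y).x w i := by
  have := d5a_pos hR
  show 0 ≤ xA Y (nR 5 w) (nB 5 w)
  unfold xA aY cY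
  split_ifs <;> positivity

/-- non-negativity of the rates -/
theorem ratesB_iota_nonneg (hR : 0 < (rSet Y).card) (w : Fin 5 → Ltr) : 0 ≤ (ratesB Y).ι w := by
  have := d5b_pos hR
  show 0 ≤ ιB Y (nR 5 w) (nB 5 w)
  unfold ιB aY cY
  split_ifs <;> positivity

/-- non-negativity of the rates -/
theorem ratesB_f_nonneg (hR : 0 < (rSet Y).card) (w : Fin 5 → Ltr) (i : Fin 5) : 0 ≤ (ratesB Y).f w i := by
  have := d5b_pos hR
  show 0 ≤ fB Y (nR 5 w) (nB 5 w)
  unfold fB aY cY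
  split_ifs <;> positivity

/-- non-negativity of the rates -/
theorem ratesB_x_nonneg (hR : 0 < (rSet Y).card) (w : Fin 5 → Ltr) (i : Fin 5) : 0 ≤ (ratesB Y).x w i := by
  have := d5b_pos hR
  show 0 ≤ xB Y (nR 5 w) (nB 5 w)
  unfold xB aY cY
  split_ifs <;> positivity

/-- `|E(2,0)| = a²(26a³ + 55a²c + 40ac² + 10c³)` -/
theorem tailCount_five_20 (hY : FlowOne Y) :
    (tailCount (parFin 5 (fun _ => Y)) 2 0 : ℚ)
      = aY Y ^ 2 * (26 * aY Y ^ 3 + 55 * aY Y ^ 2 * cY Y + 40 * aY Y * cY Y ^ 2 + 10 * cY Y ^ 3) := by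
  rw [tailCount_parFin_ident 5 Y hY 2 0]
  unfold aY cY
  simp only [Finset.sum_range_succ, Finset.sum_range_zero]
  norm_num [Nat.choose]
  ring

/-- `|E(1,1)| = a²·D₂` -/
theorem tailCount_five_11 (hY : FlowOne Y) :
    (tailCount (parFin 5 (fun _ => Y)) 1 1 : ℚ) = aY Y ^ 2 * d5a Y := by
  rw [tailCount_parFin_ident 5 Y hY 1 1]
  unfold d5a aY cY
  simp only [Finset.sum_range_succ, Finset.sum_range_zero]
  norm_num [Nat.choose]
  ring

/-- `|E(3,0)| = a³(16a² + 25ac + 10c²)` -/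
theorem tailCount_five_30 (hY : FlowOne Y) :
    (tailCount (parFin 5 (fun _ => Y)) 3 0 : ℚ) = aY Y ^ 3 * (16 * aY Y ^ 2 + 25 * aY Y * cY Y + 10 * cY Y ^ 2) := by
  rw [tailCount_parFin_ident 5 Y hY 3 0]
  unfold aY cY
  simp only [Finset.sum_range_succ, Finset.sum_range_zero]
  norm_num [Nat.choose]
  ring

/-- `|E(2,1)| = a³·D₃` -/
theorem tailCount_five_21 (hY : FlowOne Y) :
    (tailCount (parFin 5 (fun _ => Y)) 2 1 : ℚ) = aY Y ^ 3 * d5b Y := by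
  rw [tailCount_parFin_ident 5 Y hY 2 1]
  unfold d5b aY cY
  simp only [Finset.sum_range_succ, Finset.sum_range_zero]
  norm_num [Nat.choose]
  ring

/-- `γ_i = c/a` for every factor -/
theorem gam_five (i : Fin 5) : gam 5 (fun _ => Y) i = cY Y / aY Y := rfl

/-- **the source identity** at `(2,0)` -/
theorem ratesA_srcOK (hR : 0 < (rSet Y).card) : (ratesA Y).SrcOK (fun _ => Y) 2 0 := by
  intro w hw
  have h3 := nR_add_nB_add_nC 5 w
  have ha : (0 : ℚ) < aY Y := by unfold aY; exact_mod_cast hR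
  have hc : (0 : ℚ) ≤ cY Y := by unfold cY; positivity
  have hD := d5a_pos hR
  have hsum : ∀ (φ : ℚ), ∑ i ∈ redSet 5 w, φ = (nR 5 w : ℚ) * φ := by
    intro φ; rw [Finset.sum_const, ← nR_eq_card_redSet, nsmul_eq_mul]
  have hι : ∀ w', (ratesA Y).ι w' = ιA Y (nR 5 w') (nB 5 w') := fun _ => rfl
  have hf : ∀ w' i, (ratesA Y).f w' i = fA Y (nR 5 w') (nB 5 w') := fun _ _ => rfl
  have hx : ∀ w' i, (ratesA Y).x w' i = xA Y (nR 5 w') (nB 5 w') := fun _ _ => rfl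
  simp only [gam_five, hι, hf, hx]
  have hcases : (nR 5 w = 2 ∧ nB 5 w = 0) ∨ (nR 5 w = 2 ∧ nB 5 w = 1) ∨ (nR 5 w = 2 ∧ nB 5 w = 2) ∨ (nR 5 w = 2 ∧ nB 5 w = 3) ∨ (nR 5 w = 3 ∧ nB 5 w = 0) ∨ (nR 5 w = 3 ∧ nB 5 w = 1) ∨ (nR 5 w = 3 ∧ nB 5 w = 2) ∨ (nR 5 w = 4 ∧ nB 5 w = 0) ∨ (nR 5 w = 4 ∧ nB 5 w = 1) ∨ (nR 5 w = 5 ∧ nB 5 w = 0) := by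
    have := hw.1; omega
  have hcom : ocCom 5 2 0 w ↔ (2 ≤ nR 5 w ∧ 0 ≤ nB 5 w) ∧ 0 + 1 ≤ nB 5 w := Iff.rfl
  rcases hcases with ⟨hr, hb⟩ | ⟨hr, hb⟩ | ⟨hr, hb⟩ | ⟨hr, hb⟩ | ⟨hr, hb⟩ | ⟨hr, hb⟩ | ⟨hr, hb⟩ | ⟨hr, hb⟩ | ⟨hr, hb⟩ | ⟨hr, hb⟩ <;>
  · simp only [hcom, hr, hb, hsum, ιA, fA, xA]
    norm_num
    try unfold d5a
    try field_simp
    try ring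

/-- **the target identity** at `(2,0)` -/
theorem ratesA_tgtOK (hY : FlowOne Y) (hR : 0 < (rSet Y).card) : (ratesA Y).TgtOK (fun _ => Y) 2 0 := by
  intro w0 ht
  have h3 := nR_add_nB_add_nC 5 w0
  have ha : (0 : ℚ) < aY Y := by unfold aY; exact_mod_cast hR
  have hc : (0 : ℚ) ≤ cY Y := by unfold cY; positivity
  have hD := d5a_pos hR
  rw [tailCount_five_20 hY, tailCount_five_11 hY]
  have hι : ∀ w', (ratesA Y).ι w' = ιA Y (nR 5 w') (nB 5 w') := fun _ => rfl
  have hf : ∀ w' i, (ratesA Y).f w' i = fA Y (nR 5 w') (nB 5 w') := fun _ _ => rfl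
  have hx : ∀ w' i, (ratesA Y).x w' i = xA Y (nR 5 w') (nB 5 w') := fun _ _ => rfl
  simp only [hι, hf, hx]
  have hsumB : ∑ j ∈ blueSet 5 w0, (fA Y (nR 5 (Function.update w0 j Ltr.R)) (nB 5 (Function.update w0 j Ltr.R))
      + (if ocCom 5 2 0 (Function.update w0 j Ltr.R)
          then xA Y (nR 5 (Function.update w0 j Ltr.R)) (nB 5 (Function.update w0 j Ltr.R)) else 0))
      = (nB 5 w0 : ℚ) * (fA Y (nR 5 w0 + 1) (nB 5 w0 - 1)
          + (if (2 ≤ nR 5 w0 + 1 ∧ 0 ≤ nB 5 w0 - 1) ∧ 0 + 1 ≤ nB 5 w0 - 1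
            then xA Y (nR 5 w0 + 1) (nB 5 w0 - 1) else 0)) := by
    rw [nB_eq_card_blueSet, ← nsmul_eq_mul, ← Finset.sum_const]
    apply Finset.sum_congr rfl
    intro j hj
    have hjB : w0 j = Ltr.B := by simpa [blueSet] using hj
    have e1 := nR_update_R 5 w0 j (by rw [hjB]; exact Ltr.noConfusion)
    have e2 := nB_update_R_of_B 5 w0 j hjB
    have e2' : nB 5 (Function.update w0 j Ltr.R) = nB 5 w0 - 1 := by omega
    have hcom : ocCom 5 2 0 (Function.update w0 j Ltr.R)
        ↔ (2 ≤ nR 5 (Function.update w0 j Ltr.R) ∧ 0 ≤ nB 5 (Function.update w0 j Ltr.R))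
          ∧ 0 + 1 ≤ nB 5 (Function.update w0 j Ltr.R) := Iff.rfl
    simp only [hcom, e1, e2']
    rw [nB_eq_card_blueSet]
  have hsumC : ∑ l ∈ cSet 5 w0, xA Y (nR 5 (Function.update w0 l Ltr.R)) (nB 5 (Function.update w0 l Ltr.R))
      = (nC 5 w0 : ℚ) * xA Y (nR 5 w0 + 1) (nB 5 w0) := by
    show _ = ((cSet 5 w0).card : ℚ) * _
    rw [← nsmul_eq_mul, ← Finset.sum_const]
    apply Finset.sum_congr rfl
    intro l hl
    have hlC : w0 l = Ltr.C := by simpa [cSet] using hl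
    have e1 := nR_update_R 5 w0 l (by rw [hlC]; exact Ltr.noConfusion)
    have e2 := nB_update_R_of_ne 5 w0 l (by rw [hlC]; exact Ltr.noConfusion)
    rw [e1, e2]
  rw [hsumB, hsumC]
  have hcases : (nR 5 w0 = 1 ∧ nB 5 w0 = 1) ∨ (nR 5 w0 = 1 ∧ nB 5 w0 = 2) ∨ (nR 5 w0 = 1 ∧ nB 5 w0 = 3) ∨ (nR 5 w0 = 1 ∧ nB 5 w0 = 4) ∨ (nR 5 w0 = 2 ∧ nB 5 w0 = 1) ∨ (nR 5 w0 = 2 ∧ nB 5 w0 = 2) ∨ (nR 5 w0 = 2 ∧ nB 5 w0 = 3) ∨ (nR 5 w0 = 3 ∧ nB 5 w0 = 1) ∨ (nR 5 w0 = 3 ∧ nB 5 w0 = 2) ∨ (nR 5 w0 = 4 ∧ nB 5 w0 = 1) := by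
    have := ht.1; have := ht.2; omega
  have hcom : ocCom 5 2 0 w0 ↔ (2 ≤ nR 5 w0 ∧ 0 ≤ nB 5 w0) ∧ 0 + 1 ≤ nB 5 w0 := Iff.rfl
  rcases hcases with ⟨hr, hb⟩ | ⟨hr, hb⟩ | ⟨hr, hb⟩ | ⟨hr, hb⟩ | ⟨hr, hb⟩ | ⟨hr, hb⟩ | ⟨hr, hb⟩ | ⟨hr, hb⟩ | ⟨hr, hb⟩ | ⟨hr, hb⟩ <;>
  · have hnC : nC 5 w0 = 5 - nR 5 w0 - nB 5 w0 := by omega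
    simp only [hcom, hr, hb, hnC, ιA, fA, xA]
    norm_num
    try unfold d5a
    try field_simp
    try ring

end Five

end Summit.Ventures.PercRepro2.Tail2D
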